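import Summits.BirchSwinnertonDyer.Rank1Residual.X11b.TwistTransport
import Literature.NumberTheory.EllipticCurves.ManinConstantAdditivePrimesProofs
import Literature.NumberTheory.EllipticCurves.PAdicHeightsTateValuationProofs
import Literature.NumberTheory.EllipticCurves.Rank1Residual.Predicates
import Literature.NumberTheory.QuadraticForms.PadicHilbertSymbol
import HarnessLib

/-!
# Class X11b, route p2: transport of the (ram) prime and of `v_ℓ(Δ_min)` to the twist by the Heegner field (cell `b2b-bsdres`, sub-cell `multr1-p2`)

HONEST FRAMING (cell `b2b-bsdres`, run/shared/lean/b2b/bsd-rank1-residual/, verbatim in every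
file): the goal of the cell is to DELETE the COMBINATION-SHAPED residual classes of the
Birch–Swinnerton-Dyer formula for ALL analytic-rank `≤ 1` elliptic curves over `ℚ` — "full BSD
formula for every rank `≤ 1` curve in class `C`" assembled STRICTLY from published theorems — so
that the rank-`≤ 1` remainder becomes exactly the CONSTRUCTION-SHAPED classes, which are TYPED
(missing-input `Prop`s), NOT attempted. This is not "finishing BSD". Sub-cell `multr1-p2` is a
RESEARCH ROUTE on class X11b; no claim beyond the stated class and locus.

THEOREMS ONLY (tree plumbing; items (a) at `ℓ = 2` too and (c) of the transport list of
HOME/b2b-bsdres-multr1-p2/REPORT.md §5). For an imaginary quadratic `K` in which every prime of the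
conductor `N` of `E/ℚ` splits: `d_K` is a square in `ℚ_ℓ` at EVERY `ℓ ∣ N` (`ℓ` odd: `(d_K/ℓ) = 1`
and Hensel; `ℓ = 2`: `d_K ≡ 1 (mod 8)`, Serre II.3.3 Thm. 4), so `E^{(d_K)} ≅ E` over `ℚ_ℓ`; hence
(i) every model of the twist is multiplicative at every multiplicative prime of `E`
(`hasMultiplicativeReductionAtPrime_twist_of_heegner'`, no parity restriction), (ii) the minimal
discriminants of globally minimal models of `E` and `E^{(d_K)}` have the same `ℓ`-adic valuation
at such `ℓ` (`padicValInt_minimalDiscriminantInt_twist_eq`: two `ℚ_ℓ`-isomorphic `ℤ_ℓ`-minimal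
equations, Silverman *AEC* VII.1 Prop. 1.3(b); tree `padicMulValuation_Δ_smul_eq_of_isMinimal`,
`isMinimal_map_padic_of_isGloballyMinimal`), and (iii) the cell's predicate `Ram` (a multiplicative
`ℓ ≠ p` with `p ∤ v_ℓ(Δ_min)`) passes from `W` to any globally minimal model of the twist
(`ram_twist_of_heegner`). This discharges the conjunct "`Ram Wd p`" of the twist-transport binder of
`X11b/BDPRouteStatement.lean`.

References: [SilvermanAEC2009] VII.1 Prop. 1.3(b), VII.5 Prop. 5.1(b), X.5 Cor. 5.4; [Serre1973]
II §3.3 Thms. 3–4.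
-/

noncomputable section

open scoped Classical

open WeierstrassCurve NumberField Literature.NumberTheory.EllipticCurves
  Literature.NumberTheory.EllipticCurves.Rank1Residual

namespace Summit.BirchSwinnertonDyer.Rank1Residual.X11b

/-- **Under the Heegner hypothesis `d_K` is a square in `ℚ_ℓ` at every `ℓ ∣ N`.** For an imaginary
quadratic `K` and a level `N` all of whose prime factors split in `K`: at an odd `ℓ ∣ N`,
`(d_K/ℓ) = 1` (`SatisfiesHeegnerHypothesis.jacobiSym_discr_eq_one`) and Hensel's lemma
(`padic_isSquare_of_jacobiSym_eq_one`, Serre II.3.3 Thm. 3); at `ℓ = 2 ∣ N`, `d_K ≡ 1 (mod 8)`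
(`SatisfiesHeegnerHypothesis.discr_emod_eight`) and Serre II.3.3 Thm. 4
(`QuadraticForms.padic_isSquare_intCast_of_mod_eight`). [cite: Serre1973, Ch. II §3.3 Thms 3–4] -/
theorem isSquare_discr_padic_of_heegner (K : Type) [Field K] [NumberField K]
    (hK : IsImaginaryQuadratic K) {N : ℕ} (hH : SatisfiesHeegnerHypothesis N K) (ℓ : ℕ)
    [Fact ℓ.Prime] (hℓN : ℓ ∣ N) : IsSquare (algebraMap ℚ ℚ_[ℓ] (NumberField.discr K : ℚ)) := by
  have hℓ : ℓ.Prime := Fact.out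
  by_cases h2 : ℓ = 2
  · subst h2
    have h8 := Literature.SatisfiesHeegnerHypothesis.discr_emod_eight hK.1 hH hℓN
    have := Literature.NumberTheory.QuadraticForms.padic_isSquare_intCast_of_mod_eight (p := 2) rfl h8
    simpa using this
  · have hj : jacobiSym (NumberField.discr K) ℓ = 1 :=
      Literature.SatisfiesHeegnerHypothesis.jacobiSym_discr_eq_one hK.1 hH hℓ hℓN h2
    have := padic_isSquare_of_jacobiSym_eq_one (q := ℓ) h2 hj
    simpa using this

/-- **Every model of `E^{(d_K)}` is multiplicative at every multiplicative prime `ℓ` of `E`** (any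
`ℓ`, including `ℓ = 2`), for `K` satisfying the Heegner hypothesis for the conductor of `E`:
`ℓ ∣ N` (`dvd_conductorNorm_iff_not_hasGoodReductionAtPrime`), `d_K` is a square in `ℚ_ℓ`
(`isSquare_discr_padic_of_heegner`), and multiplicative reduction is invariant under the resulting
`ℚ_ℓ`-isomorphism `E^{(d_K)} ≅ E` and under `ℚ`-isomorphism
(`hasMultiplicativeReductionAtPrime_quadraticTwist_iff`, `hasMultiplicativeReductionAtPrime_smul_iff`).
[cite: SilvermanAEC2009, VII.5 Prop. 5.1(b) and X.5 Cor. 5.4] -/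
theorem hasMultiplicativeReductionAtPrime_twist_of_heegner' (W : WeierstrassCurve ℚ) [W.IsElliptic]
    (ℓ : ℕ) [Fact ℓ.Prime] (K : Type) [Field K] [NumberField K] (hK : IsImaginaryQuadratic K)
    (hH : SatisfiesHeegnerHypothesis (W.conductorNorm ℤ) K)
    (hmult : W.HasMultiplicativeReductionAtPrime ℓ) {Wd : WeierstrassCurve ℚ} (Cd : VariableChange ℚ)
    (hWd : Cd • W.quadraticTwist (NumberField.discr K : ℚ) = Wd) :
    Wd.HasMultiplicativeReductionAtPrime ℓ := by
  have hD0 : (NumberField.discr K : ℚ) ≠ 0 := by exact_mod_cast NumberField.discr_ne_zero K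
  haveI : (W.quadraticTwist (NumberField.discr K : ℚ)).IsElliptic := W.isElliptic_quadraticTwist hD0
  have hℓN : ℓ ∣ W.conductorNorm ℤ :=
    (W.dvd_conductorNorm_iff_not_hasGoodReductionAtPrime ℓ).mpr
      (WeierstrassCurve.HasMultiplicativeReduction.not_hasGoodReduction (R := ℤ_[ℓ]) hmult)
  have hsq := isSquare_discr_padic_of_heegner K hK hH ℓ hℓN
  rw [← hWd, hasMultiplicativeReductionAtPrime_smul_iff]
  exact (hasMultiplicativeReductionAtPrime_quadraticTwist_iff W hD0 hsq).mpr hmult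

/-- **`v_ℓ(Δ_min)` is the same for globally minimal models of `E` and of a twist `E^{(d)}` with `d`
a square in `ℚ_ℓ`.** For `W`, `Wd` globally minimal over `ℚ` with `Wd = Cd • W^{(d)}`, `d ∈ ℚ^×` a
square in `ℚ_ℓ`: `W ⊗ ℚ_ℓ` and `Wd ⊗ ℚ_ℓ` are `ℚ_ℓ`-isomorphic (`E^{(d)} = E^{(θ²)} ≅ E` over
`ℚ_ℓ`, `exists_variableChange_smul_eq_quadraticTwist_sq`) and both `ℤ_ℓ`-minimal
(`isMinimal_map_padic_of_isGloballyMinimal`), so their discriminants have the same valuation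
(Silverman, *AEC* VII.1 Prop. 1.3(b); tree `padicMulValuation_Δ_smul_eq_of_isMinimal`), and
`Δ(W) = Δ_min(W)`, `Δ(Wd) = Δ_min(Wd)` (`cast_minimalDiscriminantInt`).
[cite: SilvermanAEC2009, VII.1 Prop. 1.3(b) and VIII.8 (minimal discriminant)] -/
theorem padicValInt_minimalDiscriminantInt_twist_eq (W : WeierstrassCurve ℚ) [W.IsElliptic]
    [W.IsGloballyMinimal] (ℓ : ℕ) [Fact ℓ.Prime] {d : ℚ} (hd : d ≠ 0)
    (hsq : IsSquare (algebraMap ℚ ℚ_[ℓ] d)) {Wd : WeierstrassCurve ℚ} [Wd.IsElliptic]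
    [Wd.IsGloballyMinimal] (Cd : VariableChange ℚ) (hWd : Cd • W.quadraticTwist d = Wd) :
    padicValInt ℓ Wd.minimalDiscriminantInt = padicValInt ℓ W.minimalDiscriminantInt := by
  obtain ⟨θ, hθ⟩ := hsq
  have hθ0 : θ ≠ 0 := by
    rintro rfl
    exact (map_ne_zero (algebraMap ℚ ℚ_[ℓ])).mpr hd (hθ.trans (mul_zero 0))
  haveI : (W.baseChange ℚ_[ℓ]).IsElliptic :=
    inferInstanceAs (W.map (algebraMap ℚ ℚ_[ℓ])).IsElliptic
  haveI : (W.quadraticTwist d).IsElliptic := W.isElliptic_quadraticTwist hd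
  -- the two `ℤ_ℓ`-minimal models over `ℚ_ℓ`
  set X : WeierstrassCurve ℚ_[ℓ] := W.baseChange ℚ_[ℓ] with hX
  set Y : WeierstrassCurve ℚ_[ℓ] := Wd.baseChange ℚ_[ℓ] with hY
  have hXmin : X.IsMinimal ℤ_[ℓ] := isMinimal_map_padic_of_isGloballyMinimal W ℓ
  have hYmin : Y.IsMinimal ℤ_[ℓ] := isMinimal_map_padic_of_isGloballyMinimal Wd ℓ
  -- `Y = C' • X`
  obtain ⟨C, hC⟩ := (W.baseChange ℚ_[ℓ]).exists_variableChange_smul_eq_quadraticTwist_sq hθ0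
  have h1 : (W.quadraticTwist d).baseChange ℚ_[ℓ] = C • X := by
    rw [hC, baseChange, baseChange, map_quadraticTwist, hθ, sq]
  have hYX : Y = (Cd.map (algebraMap ℚ ℚ_[ℓ]) * C) • X := by
    rw [hY, ← hWd, WeierstrassCurve.VariableChange.baseChange_smul_eq (W.quadraticTwist d) Cd ℚ_[ℓ],
      h1, mul_smul]
  -- equal valuations of the discriminants
  have hmv : Padic.mulValuation Y.Δ = Padic.mulValuation X.Δ := by
    rw [hYX]
    exact padicMulValuation_Δ_smul_eq_of_isMinimal X _ hXmin (by rw [← hYX]; exact hYmin)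
  have hXΔ : X.Δ = (W.minimalDiscriminantInt : ℚ_[ℓ]) := by
    rw [hX, baseChange, map_Δ, ← cast_minimalDiscriminantInt W, map_intCast]
  have hYΔ : Y.Δ = (Wd.minimalDiscriminantInt : ℚ_[ℓ]) := by
    rw [hY, baseChange, map_Δ, ← cast_minimalDiscriminantInt Wd, map_intCast]
  have hX0 : X.Δ ≠ 0 := by
    rw [hXΔ]; exact_mod_cast minimalDiscriminantInt_ne_zero W
  have hY0 : Y.Δ ≠ 0 := by
    rw [hYΔ]; exact_mod_cast minimalDiscriminantInt_ne_zero Wd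
  rw [padicMulValuation_apply_of_ne_zero hY0, padicMulValuation_apply_of_ne_zero hX0,
    WithZero.exp_inj, neg_inj, hXΔ, hYΔ, Padic.valuation_intCast, Padic.valuation_intCast] at hmv
  exact_mod_cast hmv

/-- **The cell's (ram) predicate passes from `E` to the twist by the Heegner field.** Let `W/ℚ` be
globally minimal with a prime `ℓ ≠ p` of multiplicative reduction such that `p ∤ v_ℓ(Δ_min(E))`
(`Ram W p`: `E[p]` ramified at a second multiplicative prime), and let `K` be imaginary quadratic
satisfying the Heegner hypothesis for the conductor of `E`. Then every globally minimal model `Wd`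
of `E^{(d_K)}` satisfies `Ram Wd p` with the same witness `ℓ`: `Wd` is multiplicative at `ℓ`
(`hasMultiplicativeReductionAtPrime_twist_of_heegner'`) and `v_ℓ(Δ_min(Wd)) = v_ℓ(Δ_min(W))`
(`padicValInt_minimalDiscriminantInt_twist_eq`, `d_K` being a square in `ℚ_ℓ` by
`isSquare_discr_padic_of_heegner`). In print: "`E^{D}` and `E` are isomorphic over `ℚ_ℓ` for
`ℓ ∣ N` split in `K`" (Jetchev–Skinner–Wan 2017 §7.3.1). This discharges the conjunct "`Ram Wd p`" of
the twist-transport binder of `X11b/BDPRouteStatement.lean`.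
[cite: SilvermanAEC2009, VII.1 Prop. 1.3(b), VII.5 Prop. 5.1(b) and X.5 Cor. 5.4]
[cite: JetchevSkinnerWan2017, §7.3.1 ((eq:tamK) and the preceding sentence)] -/
theorem ram_twist_of_heegner (W : WeierstrassCurve ℚ) [W.IsElliptic] [W.IsGloballyMinimal]
    (p : ℕ) [Fact p.Prime] (K : Type) [Field K] [NumberField K] (hK : IsImaginaryQuadratic K)
    (hH : SatisfiesHeegnerHypothesis (W.conductorNorm ℤ) K) (hram : Ram W p)
    {Wd : WeierstrassCurve ℚ} [Wd.IsElliptic] [Wd.IsGloballyMinimal] (Cd : VariableChange ℚ)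
    (hWd : Cd • W.quadraticTwist (NumberField.discr K : ℚ) = Wd) : Ram Wd p := by
  obtain ⟨ℓ, hℓ, hℓp, hmult, hv⟩ := hram
  have hD0 : (NumberField.discr K : ℚ) ≠ 0 := by exact_mod_cast NumberField.discr_ne_zero K
  have hℓN : ℓ ∣ W.conductorNorm ℤ :=
    (W.dvd_conductorNorm_iff_not_hasGoodReductionAtPrime ℓ).mpr
      (WeierstrassCurve.HasMultiplicativeReduction.not_hasGoodReduction (R := ℤ_[ℓ]) hmult)
  have hsq := isSquare_discr_padic_of_heegner K hK hH ℓ hℓN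
  refine ⟨ℓ, hℓ, hℓp, hasMultiplicativeReductionAtPrime_twist_of_heegner' W ℓ K hK hH hmult Cd hWd, ?_⟩
  rw [padicValInt_minimalDiscriminantInt_twist_eq W ℓ hD0 hsq Cd hWd]
  exact hv

end Summit.BirchSwinnertonDyer.Rank1Residual.X11b

end
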